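import Literature.AlgebraicGeometry.Frobenioids.BirationalTowerBaseDeg
import Literature.AlgebraicGeometry.Frobenioids.GroupLikeBaseFunctorProofs
import Literature.AlgebraicGeometry.Frobenioids.EquivalenceBaseIdentityDivSlim
import Literature.AlgebraicGeometry.Frobenioids.BiratDivIdentityTransport
import HarnessLib

/-!
# Frobenioids I, Corollary 4.11 (ii) — the APEX of the birational tower: the typed Cor. 4.11 (ii)
# for Frobenioids in print's reduced case, from THE pieces of the tree

Mochizuki, *The geometry of Frobenioids I: the general theory*, Kyushu J. Math. **62** (2008)
293–400, Cor. 4.11 (ii) p. 91, proof p. 93 l. 30 – p. 94 l. 8 [cite: MochizukiFrdI2008, Cor. 4.11 (ii) p.93]: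

> "… we thus conclude that `Ψ^birat` preserves the base-identity endomorphisms [hence, in particular, that
> `Ψ^birat` preserves "`O^×(−)`"]. Thus, we obtain a 1-commutative diagram [`C_i^birat → (C_i^birat)^un-tr`,
> `(Ψ^birat)^un-tr`] … Since, moreover, the Frobenioids `(C_i^birat)^un-tr` are of isotropic, unit-trivial,
> and group-like type, we thus conclude that we obtain a 1-commutative diagram [`(C_i^birat)^un-tr → D_i`,
> `Ψ^Base`] [cf. Proposition 3.11, (iii)]. Thus, by composing diagrams, we obtain a 1-commutative diagram as
> in the statement of assertion (ii), which is easily verified to be 1-unique. Finally, the rigidity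
> assertion … follows from Proposition 1.13, (i)."

PROOF-ONLY file (seat abc-iut-L1-d6 = discharger of record of cell sub-DAG S2, `plan/L1/SUBDAG-FrdI-Cor411.md`;
its APEX). Compared with `BirationalTower.lean` (same seat), whose Prop. 3.11 (iii) input was a hypothesis
quantified over ALL equivalences of the `(C_i^birat)^istr`, this file DISCHARGES that input by the cell's
Prop. 3.11 (iii) (`FrdI.prop311iii_ofFunctor`, seat abc-iut-L1-t13) applied to THE operations of
`(C_i^birat)^un-tr` (`untrFunctor`, seat abc-iut-L1-d5; Prop. 3.11 setting by `prop311Setting_untr`, seat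
abc-iut-w5-d222) — whose hypothesis "`Ψ` and a quasi-inverse preserve base-identity endomorphisms" (p. 73) is
exactly print's "`Ψ^birat` preserves the base-identity endomorphisms" (p. 93 l. 45), here the hypotheses
`hbid`/`hbid'`, which also yield the units:

* `PreFrobenioid.exists_base_equivalence_of_birat` / `cor411ii_of_birat` — the base square of `Ψ`, hence the
  typed `(ofFunctor Φ₁ F₁).Cor411ii (ofFunctor Φ₂ F₂) Ψ` (`1`-uniqueness and rigidity: `BaseSquareUniqueness`,
  `…CorProofsV`), from: the birationalizations of isotropic type carrying Frobenioid structures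
  `C_i^birat → F_{0_{D_i}}` (Prop. 4.4 (ii), hypotheses `hB_i`) over bases of FSMFF-type, an equivalence
  `E : C₁^birat ⥲ C₂^birat` over `Ψ` (Cor. 4.10), and `hbid`/`hbid'`;
* `PreFrobenioid.cor411ii_inst_of_perfect` — the typed Cor. 4.11 (ii) with `hbid`/`hbid'` DISCHARGED
  (`EquivalenceBaseIdentityDivSlim` + `BiratDivIdentityTransport`, this seat) for `E := Ψ^birat` of
  Cor. 4.10 (`mapOfEquiv`, seat abc-iut-L1-t10), in the setting of the proof of Thm. 4.2 after its reductions: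
  Frobenioids of PERFECT and isotropic type with perf-factorial non-dilating `Φ_i` over Div-slim bases of
  FSMFF-type, and `Ψ`, `Ψ⁻¹` with the conclusions of Thm. 3.4 (ii)(iii) and Thm. 4.2 (i) (pre-steps,
  Frobenius type, linear morphisms, base-isomorphisms, pull-backs, primary pre-steps — the typed per-instance
  clauses, closed in the tree over FSM-type bases);
(The same over `FrdI.T42.Setting`, seat abc-iut-L1-t14: `Cor411iiBiratApexSetting.lean`.)
Residual named inputs of the node after this file: `hB_i` ("`C_i^birat` is a Frobenioid", Prop. 4.4 (ii) —
cell row W14), `HasBiratSquares`, and the istr/pf reductions of general `C_i` to the perfect isotropic case.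
No statement of the paper is restated or strengthened; no new definitions; nothing here is specific to the
abc programme.
-/

namespace Literature.AlgebraicGeometry.Frobenioids

open CategoryTheory Opposite

universe w v v' u u'

namespace PreFrobenioid

variable {D₁ : Type u} [Category.{v} D₁] {Φ₁ : D₁ᵒᵖ ⥤ CommMonCat.{w}}
  {C₁ : Type u'} [Category.{v'} C₁] {F₁ : C₁ ⥤ ElemFrobenioid Φ₁}
  {D₂ : Type u} [Category.{v} D₂] {Φ₂ : D₂ᵒᵖ ⥤ CommMonCat.{w}}
  {C₂ : Type u'} [Category.{v'} C₂] {F₂ : C₂ ⥤ ElemFrobenioid Φ₂}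

set_option backward.isDefEq.respectTransparency false in
/-- **The base square of `Ψ` from the birational tower, all floors from the tree** (FrdI proof of
Cor. 4.11 (ii), p. 93 l. 30 – p. 94 l. 7): let `C_i → F_{Φ_i}` be Frobenioids whose birationalizations
`C_i^birat` are of isotropic type and carry Frobenioid structures `C_i^birat → F_{0_{D_i}}` (Prop. 4.4 (ii),
`hB_i`) over bases of FSMFF-type, and let `E : C₁^birat ⥲ C₂^birat` lie over `Ψ` (Cor. 4.10) with `E`, `E⁻¹`
carrying base-identity endomorphisms to base-identity endomorphisms (p. 93 l. 45). Then there is an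
equivalence `Ψ^Base : D₁ ⥲ D₂` with `Base₂ ∘ Ψ ≅ Ψ^Base ∘ Base₁`: `E` preserves `O^×(−)`, hence induces
`E^un-tr` on the unit-trivializations (p. 68); these are Frobenioids of isotropic, unit-trivial, group-like
type over the zero monoids (`prop311Setting_untr`), `E^un-tr` and its quasi-inverse preserve base-identity
endomorphisms, so Prop. 3.11 (iii) (`FrdI.prop311iii_ofFunctor`) yields `Ψ^Base` under them; compose the
three floors ("composing diagrams"). [cite: MochizukiFrdI2008, Cor. 4.11 (ii) p.93] -/
theorem exists_base_equivalence_of_birat (hF₁ : IsFrobenioid F₁) (hsq₁ : HasBiratSquares F₁)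
    (hF₂ : IsFrobenioid F₂) (hsq₂ : HasBiratSquares F₂) (Ψ : C₁ ≌ C₂)
    (hB₁ : IsFrobenioid (Birat.toElemZero hF₁ hsq₁)) (hB₂ : IsFrobenioid (Birat.toElemZero hF₂ hsq₂))
    (hD₁ : IsOfFSMFFType D₁) (hD₂ : IsOfFSMFFType D₂)
    (hiso₁ : (biratOps hF₁ hsq₁).IsOfIsotropicType) (hiso₂ : (biratOps hF₂ hsq₂).IsOfIsotropicType)
    (Eb : Birat F₁ hF₁ hsq₁ ≌ Birat F₂ hF₂ hsq₂)
    (sq : toBirat F₁ hF₁ hsq₁ ⋙ Eb.functor ≅ Ψ.functor ⋙ toBirat F₂ hF₂ hsq₂)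
    (hbid : ∀ (X : Birat F₁ hF₁ hsq₁) (φ : X ⟶ X), IsBaseIdentity (Birat.toElemZero hF₁ hsq₁) φ →
      IsBaseIdentity (Birat.toElemZero hF₂ hsq₂) (Eb.functor.map φ))
    (hbid' : ∀ (Y : Birat F₂ hF₂ hsq₂) (φ : Y ⟶ Y), IsBaseIdentity (Birat.toElemZero hF₂ hsq₂) φ →
      IsBaseIdentity (Birat.toElemZero hF₁ hsq₁) (Eb.inverse.map φ)) :
    ∃ ΨBase : D₁ ⥤ D₂, ΨBase.IsEquivalence ∧
      OneCommutes Ψ.functor (PreFrobenioidData.ofFunctor Φ₂ F₂).base (PreFrobenioidData.ofFunctor Φ₁ F₁).base ΨBase := by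
  -- `E`, `E⁻¹` preserve `O^×(−)` (base-identity + linear automorphisms; isomorphisms are linear)
  have hunits : ∀ (X : Birat F₁ hF₁ hsq₁) (u : Aut X), u ∈ (biratOps hF₁ hsq₁).unitsSubgroup X →
      Eb.functor.mapIso u ∈ (biratOps hF₂ hsq₂).unitsSubgroup (Eb.functor.obj X) :=
    fun X u hu => ⟨hbid X u.hom hu.1, degFr_iso_hom (Birat.toElemZero hF₂ hsq₂) (Eb.functor.mapIso u)⟩
  have hunits' : ∀ (Y : Birat F₂ hF₂ hsq₂) (u : Aut Y), u ∈ (biratOps hF₂ hsq₂).unitsSubgroup Y →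
      Eb.inverse.mapIso u ∈ (biratOps hF₁ hsq₁).unitsSubgroup (Eb.inverse.obj Y) :=
    fun Y u hu => ⟨hbid' Y u.hom hu.1, degFr_iso_hom (Birat.toElemZero hF₁ hsq₁) (Eb.inverse.mapIso u)⟩
  -- the isotropic objects of `C_i^birat` are all objects
  let P := (biratOps hF₁ hsq₁).isotropicObjects
  let Q := (biratOps hF₂ hsq₂).isotropicObjects
  haveI : Q.IsClosedUnderIsomorphisms := ⟨fun _ _ => hiso₂.obj _⟩
  have hPQ : Q.inverseImage Eb.functor = P := by
    funext X
    exact propext ⟨fun _ => hiso₁.obj X, fun _ => hiso₂.obj _⟩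
  -- `E` on the isotropic objects preserves `≈^{O^×}`
  let G : (biratOps hF₁ hsq₁).Istr ≌ (biratOps hF₂ hsq₂).Istr := Eb.congrFullSubcategory hPQ
  have hG := PreFrobenioidData.unitEquiv_map_of_units _ _ G.functor fun X δ hδ =>
    ⟨Eb.functor.mapIso δ, hunits X.obj δ hδ, rfl⟩
  have hG' := PreFrobenioidData.unitEquiv_map_of_units _ _ G.inverse fun Y δ hδ =>
    ⟨Eb.inverse.mapIso δ, hunits' Y.obj δ hδ, rfl⟩
  -- `E^un-tr` and its square (p. 68 / p. 93: "Thus, we obtain a 1-commutative diagram")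
  obtain ⟨ΨU, hEqU, hsqU, -⟩ := PreFrobenioidData.exists_untr_oneUniqueSquare _ _ G hG hG'
  haveI := hEqU
  obtain ⟨τ⟩ := hsqU
  -- THE operations of `(C_i^birat)^un-tr` over `0_{D_i}`, in the setting of Prop. 3.11
  let SU₁ := PreFrobenioidData.ofFunctor (zeroMonoid D₁) (untrFunctor hB₁)
  let SU₂ := PreFrobenioidData.ofFunctor (zeroMonoid D₂) (untrFunctor hB₂)
  have hS₁ : PreFrobenioidData.Prop311Setting SU₁ := prop311Setting_untr hB₁ (biratOps_mon_eq_one hF₁ hsq₁) hD₁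
  have hS₂ : PreFrobenioidData.Prop311Setting SU₂ := prop311Setting_untr hB₂ (biratOps_mon_eq_one hF₂ hsq₂) hD₂
  -- `E^un-tr` and its quasi-inverse preserve base-identity endomorphisms (from `hbid`, `hbid'`)
  have hbU : ∀ (X : (biratOps hF₁ hsq₁).Untr) (g : X ⟶ X), SU₁.IsBaseIdentity g →
      SU₂.IsBaseIdentity (ΨU.asEquivalence.functor.map g) := by
    intro X g hg
    obtain ⟨a, rfl⟩ := (biratOps hF₁ hsq₁).toUntr.map_surjective (X := X.as) (Y := X.as) g
    have ha : IsBaseIdentity (Birat.toElemZero hF₁ hsq₁) a.hom := hg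
    have hGa : IsBaseIdentity (untrFunctor hB₂) ((biratOps hF₂ hsq₂).toUntr.map (G.functor.map a)) :=
      hbid _ _ ha
    have hnat : ΨU.map ((biratOps hF₁ hsq₁).toUntr.map a) =
        (τ.app X.as).inv ≫ (biratOps hF₂ hsq₂).toUntr.map (G.functor.map a) ≫ (τ.app X.as).hom := by
      have h' := τ.hom.naturality a
      change (biratOps hF₂ hsq₂).toUntr.map (G.functor.map a) ≫ τ.hom.app X.as =
        τ.hom.app X.as ≫ ΨU.map ((biratOps hF₁ hsq₁).toUntr.map a) at h'
      exact (Iso.eq_inv_comp _).mpr h'.symm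
    change IsBaseIdentity (untrFunctor hB₂) (ΨU.map ((biratOps hF₁ hsq₁).toUntr.map a))
    rw [hnat]
    exact hGa.conj_iso (τ.app X.as)
  -- the square for the quasi-inverses: `G⁻¹ ⋙ (→ un-tr₁) ≅ (→ un-tr₂) ⋙ (E^un-tr)⁻¹`
  have σ : G.inverse ⋙ (biratOps hF₁ hsq₁).toUntr ≅ (biratOps hF₂ hsq₂).toUntr ⋙ ΨU.asEquivalence.inverse :=
    (Functor.rightUnitor _).symm ≪≫ Functor.isoWhiskerLeft _ ΨU.asEquivalence.unitIso ≪≫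
      (Functor.associator _ _ _).symm ≪≫
        Functor.isoWhiskerRight
          (Functor.associator _ _ _ ≪≫ Functor.isoWhiskerLeft G.inverse τ.symm ≪≫
            (Functor.associator _ _ _).symm ≪≫ Functor.isoWhiskerRight G.counitIso _ ≪≫
              Functor.leftUnitor _) _
  have hbU' : ∀ (Y : (biratOps hF₂ hsq₂).Untr) (g : Y ⟶ Y), SU₂.IsBaseIdentity g →
      SU₁.IsBaseIdentity (ΨU.asEquivalence.inverse.map g) := by
    intro Y g hg
    obtain ⟨b, rfl⟩ := (biratOps hF₂ hsq₂).toUntr.map_surjective (X := Y.as) (Y := Y.as) g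
    have hb : IsBaseIdentity (Birat.toElemZero hF₂ hsq₂) b.hom := hg
    have hGb : IsBaseIdentity (untrFunctor hB₁) ((biratOps hF₁ hsq₁).toUntr.map (G.inverse.map b)) :=
      hbid' _ _ hb
    have hnat : ΨU.asEquivalence.inverse.map ((biratOps hF₂ hsq₂).toUntr.map b) =
        (σ.app Y.as).inv ≫ (biratOps hF₁ hsq₁).toUntr.map (G.inverse.map b) ≫ (σ.app Y.as).hom := by
      have h' := σ.hom.naturality b
      change (biratOps hF₁ hsq₁).toUntr.map (G.inverse.map b) ≫ σ.hom.app Y.as =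
        σ.hom.app Y.as ≫ ΨU.asEquivalence.inverse.map ((biratOps hF₂ hsq₂).toUntr.map b) at h'
      exact (Iso.eq_inv_comp _).mpr h'.symm
    change IsBaseIdentity (untrFunctor hB₁) (ΨU.asEquivalence.inverse.map ((biratOps hF₂ hsq₂).toUntr.map b))
    rw [hnat]
    exact hGb.conj_iso (σ.app Y.as)
  -- Prop. 3.11 (iii): `Ψ^Base` under `E^un-tr`
  obtain ⟨ΨBase, ⟨hEqB, hsqB, -⟩, -⟩ := FrdI.prop311iii_ofFunctor (isFrobenioid_untr hB₁)
    (isFrobenioid_untr hB₂) ΨU.asEquivalence hS₁ hS₂ hbU hbU'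
  refine ⟨ΨBase, hEqB, ?_⟩
  -- the functors `C_i → C_i^birat → (C_i^birat)^istr → (C_i^birat)^un-tr`
  let L₁ : C₁ ⥤ (biratOps hF₁ hsq₁).Istr := P.lift (toBirat F₁ hF₁ hsq₁) fun A => hiso₁.obj _
  let L₂ : C₂ ⥤ (biratOps hF₂ hsq₂).Istr := Q.lift (toBirat F₂ hF₂ hsq₂) fun A => hiso₂.obj _
  -- `Base_i` factors through `C_i → (C_i^birat)^un-tr` (on the nose at each floor)
  have ιU₁ : (biratOps hF₁ hsq₁).toUntr ⋙ SU₁.base ≅ (biratOps hF₁ hsq₁).istrι ⋙ (biratOps hF₁ hsq₁).base :=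
    eqToIso (Functor.hext (fun _ => rfl) fun _ _ a => heq_of_eq (base_toUntr (hF := hB₁) a))
  have ιU₂ : (biratOps hF₂ hsq₂).toUntr ⋙ SU₂.base ≅ (biratOps hF₂ hsq₂).istrι ⋙ (biratOps hF₂ hsq₂).base :=
    eqToIso (Functor.hext (fun _ => rfl) fun _ _ a => heq_of_eq (base_toUntr (hF := hB₂) a))
  have ι₁ : (L₁ ⋙ (biratOps hF₁ hsq₁).toUntr) ⋙ SU₁.base ≅ (PreFrobenioidData.ofFunctor Φ₁ F₁).base :=
    Functor.associator _ _ _ ≪≫ Functor.isoWhiskerLeft L₁ ιU₁ ≪≫ (Functor.associator _ _ _).symm ≪≫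
      Functor.isoWhiskerRight (P.liftCompιIso _ _) _ ≪≫ biratOverBase hF₁ hsq₁
  have ι₂ : (L₂ ⋙ (biratOps hF₂ hsq₂).toUntr) ⋙ SU₂.base ≅ (PreFrobenioidData.ofFunctor Φ₂ F₂).base :=
    Functor.associator _ _ _ ≪≫ Functor.isoWhiskerLeft L₂ ιU₂ ≪≫ (Functor.associator _ _ _).symm ≪≫
      Functor.isoWhiskerRight (Q.liftCompιIso _ _) _ ≪≫ biratOverBase hF₂ hsq₂
  -- `Ψ` over `C_i → (C_i^birat)^istr`: the square `sq` lifted to the full subcategories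
  have sqI : L₁ ⋙ G.functor ≅ Ψ.functor ⋙ L₂ :=
    (Q.fullyFaithfulι.whiskeringRight C₁).preimageIso sq
  -- `Ψ` over `C_i → (C_i^birat)^un-tr`
  have hT : OneCommutes Ψ.functor (L₂ ⋙ (biratOps hF₂ hsq₂).toUntr) (L₁ ⋙ (biratOps hF₁ hsq₁).toUntr)
      ΨU.asEquivalence.functor :=
    ⟨(Functor.associator _ _ _).symm ≪≫ Functor.isoWhiskerRight sqI.symm _ ≪≫ Functor.associator _ _ _ ≪≫
      Functor.isoWhiskerLeft L₁ τ ≪≫ (Functor.associator _ _ _).symm⟩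
  -- "by composing diagrams"
  exact PreFrobenioidData.oneCommutes_base_of_tower _ _ Ψ SU₁ SU₂ _ _ ι₁ ι₂ _ hT ΨBase hsqB

/-- **Corollary 4.11 (ii) from the birational tower, Prop. 3.11 (iii) discharged** (FrdI pp. 93–94): under
the hypotheses of `exists_base_equivalence_of_birat`, the typed Cor. 4.11 (ii) holds for `Ψ` — `1`-uniqueness
("easily verified to be 1-unique") and rigidity for slim bases (Prop. 1.13 (i)) being theorems for
Frobenioids (`cor411ii_of_exists_base_equivalence'`). [cite: MochizukiFrdI2008, Cor. 4.11 (ii) p.91] -/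
theorem cor411ii_of_birat (hF₁ : IsFrobenioid F₁) (hsq₁ : HasBiratSquares F₁)
    (hF₂ : IsFrobenioid F₂) (hsq₂ : HasBiratSquares F₂) (Ψ : C₁ ≌ C₂)
    (hB₁ : IsFrobenioid (Birat.toElemZero hF₁ hsq₁)) (hB₂ : IsFrobenioid (Birat.toElemZero hF₂ hsq₂))
    (hD₁ : IsOfFSMFFType D₁) (hD₂ : IsOfFSMFFType D₂)
    (hiso₁ : (biratOps hF₁ hsq₁).IsOfIsotropicType) (hiso₂ : (biratOps hF₂ hsq₂).IsOfIsotropicType)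
    (Eb : Birat F₁ hF₁ hsq₁ ≌ Birat F₂ hF₂ hsq₂)
    (sq : toBirat F₁ hF₁ hsq₁ ⋙ Eb.functor ≅ Ψ.functor ⋙ toBirat F₂ hF₂ hsq₂)
    (hbid : ∀ (X : Birat F₁ hF₁ hsq₁) (φ : X ⟶ X), IsBaseIdentity (Birat.toElemZero hF₁ hsq₁) φ →
      IsBaseIdentity (Birat.toElemZero hF₂ hsq₂) (Eb.functor.map φ))
    (hbid' : ∀ (Y : Birat F₂ hF₂ hsq₂) (φ : Y ⟶ Y), IsBaseIdentity (Birat.toElemZero hF₂ hsq₂) φ →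
      IsBaseIdentity (Birat.toElemZero hF₁ hsq₁) (Eb.inverse.map φ)) :
    (PreFrobenioidData.ofFunctor Φ₁ F₁).Cor411ii (PreFrobenioidData.ofFunctor Φ₂ F₂) Ψ :=
  cor411ii_of_exists_base_equivalence' F₁ F₂ Ψ hF₁ hF₂
    (exists_base_equivalence_of_birat hF₁ hsq₁ hF₂ hsq₂ Ψ hB₁ hB₂ hD₁ hD₂ hiso₁ hiso₂ Eb sq hbid hbid')

/-! ### The apex: `E := Ψ^birat`, `hbid` from Thm. 4.2 (ii) + Div-slimness -/

set_option backward.isDefEq.respectTransparency false in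
/-- **The base square of [FrdI] Cor. 4.11 (ii), in the setting of the proof of Thm. 4.2 after its reductions**
(print: "we may assume without loss of generality that `C₁, C₂` are of isotropic type … not of group-like
type", p. 92; "by passing to perfections", p. 89): for Frobenioids `C_i → F_{Φ_i}` of PERFECT and isotropic
type with `Φ_i` perf-factorial and non-dilating (Def. 3.1 (i)(e)) over Div-slim bases `D_i` of FSMFF-type,
whose birationalizations carry Frobenioid structures `C_i^birat → F_{0_{D_i}}` (Prop. 4.4 (ii), `hB_i`), and
an equivalence `Ψ` such that `Ψ`, `Ψ⁻¹` preserve pre-steps (Thm. 3.4 (ii)), morphisms of Frobenius type,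
linear morphisms, base-isomorphisms and pull-back morphisms (Thm. 3.4 (iii)) and primary pre-steps (Thm. 4.2
(i)): there is an equivalence `Ψ^Base : D₁ ⥲ D₂` with `Base₂ ∘ Ψ ≅ Ψ^Base ∘ Base₁` (for the typed
`Cor411ii`: `cor411ii_inst_of_perfect`). ASSEMBLY: `E := Ψ^birat` (Cor. 4.10, `mapOfEquiv` with quasi-inverse
`mapOfEquiv Ψ⁻¹`); `E`, `E⁻¹` carry base-identity endomorphisms to `Φ`-identity ones
(`Birat.pull_base_mapOfEquiv_map_eq_id'`: Thm. 4.2 (ii) + perf-factorial + non-dilating), hence to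
base-identity ones (`isBaseIdentity_map_of_isDivSlim`: Div-slimness; Def. 1.3 (i)(c) for `C^birat` by
`Birat.pullbackSliceToBase_toElemZero_isEquivalence`, seat abc-iut-w4-d109; base-isomorphisms / pull-backs of
`C^birat` by seats abc-iut-L6-t20 / abc-iut-w4-d109); then `cor411ii_of_birat`.
[cite: MochizukiFrdI2008, Cor. 4.11 (ii) p.91] -/
theorem exists_base_equivalence_inst_of_perfect (hF₁ : IsFrobenioid F₁) (hsq₁ : HasBiratSquares F₁)
    (hF₂ : IsFrobenioid F₂) (hsq₂ : HasBiratSquares F₂) (Ψ : C₁ ≌ C₂)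
    (hB₁ : IsFrobenioid (Birat.toElemZero hF₁ hsq₁)) (hB₂ : IsFrobenioid (Birat.toElemZero hF₂ hsq₂))
    (hD₁ : IsOfFSMFFType D₁) (hD₂ : IsOfFSMFFType D₂)
    (hperf₁ : IsOfPerfectType F₁) (hperf₂ : IsOfPerfectType F₂)
    (hiso₁ : IsOfIsotropicType F₁) (hiso₂ : IsOfIsotropicType F₂)
    (hpf₁ : Objectwise (fun M _ => IsPerfFactorial M) Φ₁) (hpf₂ : Objectwise (fun M _ => IsPerfFactorial M) Φ₂)
    (hnd₁ : IsNonDilatingOn Φ₁) (hnd₂ : IsNonDilatingOn Φ₂)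
    (hds₁ : (PreFrobenioidData.ofFunctor Φ₁ F₁).IsDivSlim) (hds₂ : (PreFrobenioidData.ofFunctor Φ₂ F₂).IsDivSlim)
    (hpre : ∀ ⦃X Y : C₁⦄ (φ : X ⟶ Y), IsPreStep F₁ φ → IsPreStep F₂ (Ψ.functor.map φ))
    (hpre' : ∀ ⦃X Y : C₂⦄ (φ : X ⟶ Y), IsPreStep F₂ φ → IsPreStep F₁ (Ψ.inverse.map φ))
    (hfrob : ∀ ⦃X Y : C₁⦄ (φ : X ⟶ Y), IsFrobeniusType F₁ φ → IsFrobeniusType F₂ (Ψ.functor.map φ))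
    (hfrob' : ∀ ⦃X Y : C₂⦄ (φ : X ⟶ Y), IsFrobeniusType F₂ φ → IsFrobeniusType F₁ (Ψ.inverse.map φ))
    (hlin : ∀ ⦃X Y : C₁⦄ (φ : X ⟶ Y), IsLinear F₁ φ → IsLinear F₂ (Ψ.functor.map φ))
    (hlin' : ∀ ⦃X Y : C₂⦄ (φ : X ⟶ Y), IsLinear F₂ φ → IsLinear F₁ (Ψ.inverse.map φ))
    (hbi : ∀ ⦃X Y : C₁⦄ (φ : X ⟶ Y), IsBaseIso F₁ φ → IsBaseIso F₂ (Ψ.functor.map φ))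
    (hbi' : ∀ ⦃X Y : C₂⦄ (φ : X ⟶ Y), IsBaseIso F₂ φ → IsBaseIso F₁ (Ψ.inverse.map φ))
    (hpb : ∀ ⦃X Y : C₁⦄ (φ : X ⟶ Y), IsPullbackMorphism F₁ φ → IsPullbackMorphism F₂ (Ψ.functor.map φ))
    (hpb' : ∀ ⦃X Y : C₂⦄ (φ : X ⟶ Y), IsPullbackMorphism F₂ φ → IsPullbackMorphism F₁ (Ψ.inverse.map φ))
    (hprim : ∀ ⦃X Y : C₁⦄ (φ : X ⟶ Y), IsPrimaryPreStep F₁ φ → IsPrimaryPreStep F₂ (Ψ.functor.map φ))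
    (hprim' : ∀ ⦃X Y : C₂⦄ (φ : X ⟶ Y), IsPrimaryPreStep F₂ φ → IsPrimaryPreStep F₁ (Ψ.inverse.map φ)) :
    ∃ ΨBase : D₁ ⥤ D₂, ΨBase.IsEquivalence ∧
      OneCommutes Ψ.functor (PreFrobenioidData.ofFunctor Φ₂ F₂).base (PreFrobenioidData.ofFunctor Φ₁ F₁).base ΨBase := by
  -- co-angular pre-steps (all pre-steps are co-angular in isotropic type)
  have hΨ : ∀ ⦃A B : C₁⦄ (f : A ⟶ B), IsCoAngularPreStep F₁ f → IsCoAngularPreStep F₂ (Ψ.functor.map f) :=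
    fun A B f hf => isCoAngularPreStep_of_isotropic hiso₂ (hpre f hf.2)
  have hΨ' : ∀ ⦃A B : C₂⦄ (f : A ⟶ B), IsCoAngularPreStep F₂ f → IsCoAngularPreStep F₁ (Ψ.inverse.map f) :=
    fun A B f hf => isCoAngularPreStep_of_isotropic hiso₁ (hpre' f hf.2)
  -- `Ψ^birat` (Cor. 4.10) as an equivalence with functor `mapOfEquiv Ψ` and inverse `mapOfEquiv Ψ⁻¹`
  haveI := toBirat_isLocalization hF₁ hsq₁
  haveI := toBirat_isLocalization hF₂ hsq₂
  letI := Birat.liftingMapOfEquiv hF₁ hsq₁ hF₂ hsq₂ Ψ hΨ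
  let F' : Birat F₂ hF₂ hsq₂ ⥤ Birat F₁ hF₁ hsq₁ := Birat.mapOfEquiv hF₂ hsq₂ hF₁ hsq₁ Ψ.symm hΨ'
  let fac' : toBirat F₂ hF₂ hsq₂ ⋙ F' ≅ Ψ.inverse ⋙ toBirat F₁ hF₁ hsq₁ :=
    Birat.mapOfEquivFac hF₂ hsq₂ hF₁ hsq₁ Ψ.symm hΨ'
  letI : Localization.Lifting (toBirat F₂ hF₂ hsq₂) (coAngularPreSteps F₂)
      (Ψ.inverse ⋙ toBirat F₁ hF₁ hsq₁) F' := ⟨fac'⟩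
  let α : (Ψ.functor ⋙ toBirat F₂ hF₂ hsq₂) ⋙ F' ≅ toBirat F₁ hF₁ hsq₁ :=
    Functor.associator _ _ _ ≪≫ Functor.isoWhiskerLeft Ψ.functor fac' ≪≫
      (Functor.associator _ _ _).symm ≪≫ Functor.isoWhiskerRight Ψ.unitIso.symm _ ≪≫
        Functor.leftUnitor _
  let β : (Ψ.inverse ⋙ toBirat F₁ hF₁ hsq₁) ⋙ Birat.mapOfEquiv hF₁ hsq₁ hF₂ hsq₂ Ψ hΨ ≅
      toBirat F₂ hF₂ hsq₂ :=
    Functor.associator _ _ _ ≪≫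
      Functor.isoWhiskerLeft Ψ.inverse (Birat.mapOfEquivFac hF₁ hsq₁ hF₂ hsq₂ Ψ hΨ) ≪≫
        (Functor.associator _ _ _).symm ≪≫ Functor.isoWhiskerRight Ψ.counitIso _ ≪≫
          Functor.leftUnitor _
  let Eb : Birat F₁ hF₁ hsq₁ ≌ Birat F₂ hF₂ hsq₂ :=
    Localization.equivalence (toBirat F₁ hF₁ hsq₁) (coAngularPreSteps F₁) (toBirat F₂ hF₂ hsq₂)
      (coAngularPreSteps F₂) (Ψ.functor ⋙ toBirat F₂ hF₂ hsq₂) (Birat.mapOfEquiv hF₁ hsq₁ hF₂ hsq₂ Ψ hΨ)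
      (Ψ.inverse ⋙ toBirat F₁ hF₁ hsq₁) F' α β
  -- Div-slimness and Def. 1.3 (i)(c) for the birationalizations, in the shapes of `isBaseIdentity_map_of_isDivSlim`
  have hds₁' : ∀ (X : D₁) (a : Aut (Over.forget X)),
      (∀ (V : Over X) (x : Φ₁.obj (op V.left)), pull Φ₁ (a.hom.app V) x = x) → a = 1 :=
    fun X a h => hds₁.eq_one X a fun V x => h V x
  have hds₂' : ∀ (X : D₂) (a : Aut (Over.forget X)),
      (∀ (V : Over X) (x : Φ₂.obj (op V.left)), pull Φ₂ (a.hom.app V) x = x) → a = 1 :=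
    fun X a h => hds₂.eq_one X a fun V x => h V x
  have hic₁ := Birat.pullbackSliceToBase_toElemZero_isEquivalence hF₁ hsq₁
  have hic₂ := Birat.pullbackSliceToBase_toElemZero_isEquivalence hF₂ hsq₂
  -- `Ψ^birat`, `(Ψ⁻¹)^birat` preserve base-isomorphisms (Prop. 4.4 (iv) + Thm. 3.4 (iii)) and pull-backs
  have hbiE : ∀ ⦃X Y : Birat F₁ hF₁ hsq₁⦄ (g : X ⟶ Y), IsBaseIso (Birat.toElemZero hF₁ hsq₁) g →
      IsBaseIso (Birat.toElemZero hF₂ hsq₂) (Eb.functor.map g) :=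
    fun X Y g hg => Birat.isBaseIso_mapOfEquiv_map hF₁ hsq₁ hF₂ hsq₂ Ψ hΨ hbi g hg
  have hbiE' : ∀ ⦃X Y : Birat F₂ hF₂ hsq₂⦄ (g : X ⟶ Y), IsBaseIso (Birat.toElemZero hF₂ hsq₂) g →
      IsBaseIso (Birat.toElemZero hF₁ hsq₁) (Eb.inverse.map g) :=
    fun X Y g hg => Birat.isBaseIso_mapOfEquiv_map hF₂ hsq₂ hF₁ hsq₁ Ψ.symm hΨ' hbi' g hg
  have hpbE : ∀ ⦃X Y : Birat F₁ hF₁ hsq₁⦄ (δ : X ⟶ Y), IsPullbackMorphism (Birat.toElemZero hF₁ hsq₁) δ →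
      IsPullbackMorphism (Birat.toElemZero hF₂ hsq₂) (Eb.functor.map δ) :=
    Birat.isPullbackMorphism_mapOfEquiv_map hF₁ hsq₁ hF₂ hsq₂ Ψ hΨ hiso₁ hiso₂ hlin
  have hpbE' : ∀ ⦃X Y : Birat F₂ hF₂ hsq₂⦄ (δ : X ⟶ Y), IsPullbackMorphism (Birat.toElemZero hF₂ hsq₂) δ →
      IsPullbackMorphism (Birat.toElemZero hF₁ hsq₁) (Eb.inverse.map δ) :=
    Birat.isPullbackMorphism_mapOfEquiv_map hF₂ hsq₂ hF₁ hsq₁ Ψ.symm hΨ' hiso₂ hiso₁ hlin'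
  -- Thm. 4.2 (ii) + perf-factorial + non-dilating: base-identity endomorphisms go to `Φ`-identity ones
  have hdi : ∀ (X : Birat F₁ hF₁ hsq₁) (φ : X ⟶ X), IsBaseIdentity (Birat.toElemZero hF₁ hsq₁) φ →
      pull Φ₂ (Base (Birat.toElemZero hF₂ hsq₂) (Eb.functor.map φ)) = MonoidHom.id _ :=
    fun X φ hφ => Birat.pull_base_mapOfEquiv_map_eq_id' hF₁ hsq₁ hF₂ hsq₂ Ψ hΨ hperf₁ hperf₂ hiso₁ hiso₂
      hpf₁ hpf₂ hnd₂ hpre hpre' hfrob hpb hprim hprim' X φ (pull_base_eq_id_of_isBaseIdentity hφ)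
  have hdi' : ∀ (Y : Birat F₂ hF₂ hsq₂) (φ : Y ⟶ Y), IsBaseIdentity (Birat.toElemZero hF₂ hsq₂) φ →
      pull Φ₁ (Base (Birat.toElemZero hF₁ hsq₁) (Eb.inverse.map φ)) = MonoidHom.id _ :=
    fun Y φ hφ => Birat.pull_base_mapOfEquiv_map_eq_id' hF₂ hsq₂ hF₁ hsq₁ Ψ.symm hΨ' hperf₂ hperf₁ hiso₂
      hiso₁ hpf₂ hpf₁ hnd₁ hpre' hpre hfrob' hpb' hprim' hprim Y φ (pull_base_eq_id_of_isBaseIdentity hφ)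
  -- Div-slimness: hence to base-identity ones (p. 93 l. 45)
  have hbid : ∀ (X : Birat F₁ hF₁ hsq₁) (φ : X ⟶ X), IsBaseIdentity (Birat.toElemZero hF₁ hsq₁) φ →
      IsBaseIdentity (Birat.toElemZero hF₂ hsq₂) (Eb.functor.map φ) :=
    fun X φ hφ => isBaseIdentity_map_of_isDivSlim (Φ₂ := Φ₂) hic₂ hds₂' Eb hbiE hpbE' hdi hφ
  have hbid' : ∀ (Y : Birat F₂ hF₂ hsq₂) (φ : Y ⟶ Y), IsBaseIdentity (Birat.toElemZero hF₂ hsq₂) φ →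
      IsBaseIdentity (Birat.toElemZero hF₁ hsq₁) (Eb.inverse.map φ) :=
    fun Y φ hφ => isBaseIdentity_map_of_isDivSlim (Φ₂ := Φ₁) hic₁ hds₁' Eb.symm hbiE' hpbE hdi' hφ
  exact exists_base_equivalence_of_birat hF₁ hsq₁ hF₂ hsq₂ Ψ hB₁ hB₂ hD₁ hD₂
    (PreFrobenioidData.isOfIsotropicType_ofFunctor_toElemZero hF₁ hsq₁
      ((PreFrobenioidData.ofFunctor_isOfIsotropicType F₁).mpr hiso₁))
    (PreFrobenioidData.isOfIsotropicType_ofFunctor_toElemZero hF₂ hsq₂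
      ((PreFrobenioidData.ofFunctor_isOfIsotropicType F₂).mpr hiso₂))
    Eb (Birat.mapOfEquivFac hF₁ hsq₁ hF₂ hsq₂ Ψ hΨ) hbid hbid'

/-- **[FrdI] Cor. 4.11 (ii) AS TYPED in the perfect isotropic case** — `exists_base_equivalence_inst_of_perfect`
followed by the `1`-uniqueness and rigidity theorems (`cor411ii_of_exists_base_equivalence'`).
[cite: MochizukiFrdI2008, Cor. 4.11 (ii) p.91] -/
theorem cor411ii_inst_of_perfect (hF₁ : IsFrobenioid F₁) (hsq₁ : HasBiratSquares F₁)
    (hF₂ : IsFrobenioid F₂) (hsq₂ : HasBiratSquares F₂) (Ψ : C₁ ≌ C₂)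
    (hB₁ : IsFrobenioid (Birat.toElemZero hF₁ hsq₁)) (hB₂ : IsFrobenioid (Birat.toElemZero hF₂ hsq₂))
    (hD₁ : IsOfFSMFFType D₁) (hD₂ : IsOfFSMFFType D₂)
    (hperf₁ : IsOfPerfectType F₁) (hperf₂ : IsOfPerfectType F₂)
    (hiso₁ : IsOfIsotropicType F₁) (hiso₂ : IsOfIsotropicType F₂)
    (hpf₁ : Objectwise (fun M _ => IsPerfFactorial M) Φ₁) (hpf₂ : Objectwise (fun M _ => IsPerfFactorial M) Φ₂)
    (hnd₁ : IsNonDilatingOn Φ₁) (hnd₂ : IsNonDilatingOn Φ₂)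
    (hds₁ : (PreFrobenioidData.ofFunctor Φ₁ F₁).IsDivSlim) (hds₂ : (PreFrobenioidData.ofFunctor Φ₂ F₂).IsDivSlim)
    (hpre : ∀ ⦃X Y : C₁⦄ (φ : X ⟶ Y), IsPreStep F₁ φ → IsPreStep F₂ (Ψ.functor.map φ))
    (hpre' : ∀ ⦃X Y : C₂⦄ (φ : X ⟶ Y), IsPreStep F₂ φ → IsPreStep F₁ (Ψ.inverse.map φ))
    (hfrob : ∀ ⦃X Y : C₁⦄ (φ : X ⟶ Y), IsFrobeniusType F₁ φ → IsFrobeniusType F₂ (Ψ.functor.map φ))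
    (hfrob' : ∀ ⦃X Y : C₂⦄ (φ : X ⟶ Y), IsFrobeniusType F₂ φ → IsFrobeniusType F₁ (Ψ.inverse.map φ))
    (hlin : ∀ ⦃X Y : C₁⦄ (φ : X ⟶ Y), IsLinear F₁ φ → IsLinear F₂ (Ψ.functor.map φ))
    (hlin' : ∀ ⦃X Y : C₂⦄ (φ : X ⟶ Y), IsLinear F₂ φ → IsLinear F₁ (Ψ.inverse.map φ))
    (hbi : ∀ ⦃X Y : C₁⦄ (φ : X ⟶ Y), IsBaseIso F₁ φ → IsBaseIso F₂ (Ψ.functor.map φ))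
    (hbi' : ∀ ⦃X Y : C₂⦄ (φ : X ⟶ Y), IsBaseIso F₂ φ → IsBaseIso F₁ (Ψ.inverse.map φ))
    (hpb : ∀ ⦃X Y : C₁⦄ (φ : X ⟶ Y), IsPullbackMorphism F₁ φ → IsPullbackMorphism F₂ (Ψ.functor.map φ))
    (hpb' : ∀ ⦃X Y : C₂⦄ (φ : X ⟶ Y), IsPullbackMorphism F₂ φ → IsPullbackMorphism F₁ (Ψ.inverse.map φ))
    (hprim : ∀ ⦃X Y : C₁⦄ (φ : X ⟶ Y), IsPrimaryPreStep F₁ φ → IsPrimaryPreStep F₂ (Ψ.functor.map φ))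
    (hprim' : ∀ ⦃X Y : C₂⦄ (φ : X ⟶ Y), IsPrimaryPreStep F₂ φ → IsPrimaryPreStep F₁ (Ψ.inverse.map φ)) :
    (PreFrobenioidData.ofFunctor Φ₁ F₁).Cor411ii (PreFrobenioidData.ofFunctor Φ₂ F₂) Ψ :=
  cor411ii_of_exists_base_equivalence' F₁ F₂ Ψ hF₁ hF₂
    (exists_base_equivalence_inst_of_perfect hF₁ hsq₁ hF₂ hsq₂ Ψ hB₁ hB₂ hD₁ hD₂ hperf₁ hperf₂ hiso₁ hiso₂
      hpf₁ hpf₂ hnd₁ hnd₂ hds₁ hds₂ hpre hpre' hfrob hfrob' hlin hlin' hbi hbi' hpb hpb' hprim hprim')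

end PreFrobenioid

end Literature.AlgebraicGeometry.Frobenioids
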